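import Literature.NumberTheory.Automorphic.Liu2021.AppendixC.JacobianGaloisCoverTrace
import Literature.AlgebraicGeometry.Motives.AbelianVarietyLevelAdjointCalculus
import Literature.AlgebraicGeometry.Motives.JacobianCorrespondenceLevelAdjoint
import Literature.AlgebraicGeometry.Motives.AlgPointsMapSurjectiveAlgClosed
import Literature.AlgebraicGeometry.Motives.AbelianVarietyDimZeroProofs
import Literature.AlgebraicGeometry.Motives.AbelianVarietyWeilPairingAlgClosure
import HarnessLib

/-!
# The level adjoint of ONE ENTRY `q₁^* ≫ Nm_{T}` of a complex Hecke word, `T` dominated by a Galois cover (Mumford §20 (3); LR22 (3.3))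

Topic `NumberTheory/Automorphic/Liu2021/AppendixC`; namespace `Literature.NumberTheory.Automorphic.Liu2021.AppendixC`.
PROOF FILE (theorems only; no definition, no named fact, no instance, no `sorry`).  Generic over complex curves: nothing of the
unitary tower is mentioned; the named fact (F-P2) ★ `Jacobian.galoisCover_pullback_isWeilPairingAdjoint_norm` is a per-theorem
hypothesis.

THE SITUATION (cell `hodgecm-mathlib`, d6 line, `stub_RosH` glue, (L3) «entry recipe» of record, A-plan2 (g12) 2026-08-30T05:05Z;
hand (hf) of the frame `slot_letters`).  Four smooth projective geometrically irreducible complex curves and three covers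

  `X_c −tu→ X_a`  (a piece of the level cover `u : X_N → X_K`, Galois by `H_u ≤ Aut X_c`),
  `X_z −q→ X_c`   (a piece of `q′ = T_{γ⁻¹} : X_{N″} → X_N`, Galois by `H_q ≤ Aut X_z`, ★ `HeckeTranslateSepQuotient`),
  `X_z −u′→ X_b`  (a piece of `u″ : X_{N″} → X_K`, Galois by `H_z ≤ Aut X_z`),

and the piece `tp : X_c → X_b` of the translate `T_γ : X_N → X_K`, NOT Galois but DOMINATED: `q ≫ tp = u′`.  With Jacobians
`J_a, J_c, J_z, J_b`, Riemann theta divisors `W_•` defining the canonical principal polarisations, and the pinned pull-back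
`tt : J_a → J_c` of `tu` (`Nm_{tu} ≫ tt = Σ_{h ∈ H_u} h_*`), the word entry is `f := tt ≫ Nm_{tp} : J_a → J_b` and:

* §0 `natCast_ne_zero_of_isDominant_zsmul` / `isDominant_zsmul_of_isDominant_zsmul` — if `[N]` is dominant on an abelian
  variety of POSITIVE dimension then `N ≠ 0`, so `[N]` is dominant on every abelian variety in characteristic `0` (the
  dominance bookkeeping `hZ`/`hY` of ★ `levelAdjoint_pushforward_of_dominated'` / ★ `levelAdjoint_fan_sum`, DISCHARGED);
* §1 **`Jacobian.exists_entry_levelAdjoint`** — `∃ tz : J_b → J_z` (the pinned pull-back of `u′`, ★ `Jacobian.exists_pushforward_comp_eq_sum`)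
  with `Nm_{u′} ≫ tz = Σ_{h ∈ H_z} h_*` and, at every level,
  **`ē_N^{W_b}((#H_q · f) P, Q) = ē_N^{W_a}(P, (tz ≫ Nm_q ≫ Nm_{tu}) Q)`** — the pair `(f, tz ≫ Nm_q ≫ Nm_{tu})` of RAW WEIGHT
  `#H_q` for `(W_a, W_b)`, verbatim the `hf` letter of `slot_levelAdjoint_of_letters_weighted` (one entry), with the transposed
  entry `u′^* ≫ Nm_{q ≫ tu}` = the piece of `u″^* ≫ Nm(T_{γ⁻¹}^{N″ → K})` that the (hxd) junction recognises.
  Proof = ★ (F-P2) thrice (★ `Jacobian.exists_galoisCover_letters`: `tu`, `q`, `u′`), ★ `levelAdjoint_one_of_plain`, ★ (1′)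
  `levelAdjoint_pushforward_of_dominated'` (`hnf` = ★ `pushforward_comp` on `q ≫ tp = u′`, `hdeg` = the degree conjunct of the `q`-package,
  `hdiv` = ★ `forall_pow_surjective_of_isDominant`, `hZ` = §0), ★ `levelAdjoint_comp_plain_weighted` (restated privately).

COUNT-NEUTRAL capital: HC_CM is proved only modulo the 7 printed citations until rung 0 closes; §1 is conditional on (F-P2).

## References
* [MumfordAV1970] D. Mumford, *Abelian Varieties* (1970), §20 p. 186, property (3) of `e_n`; §6 Prop. p. 64 (`n_X` is an isogeny).
* [LangeRodriguez2022] H. Lange, R. E. Rodríguez, *Decomposition of Jacobians by Prym Varieties*, LNM 2310 (2022), §3.2.1 eq. (3.3)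
  (pp. 46–47), §3.5.1 Prop. 3.5.1 (p. 65).
* [Lang1983AbelianVarieties] S. Lang, *Abelian Varieties* (1983), Ch. VII §2 Thm. 5 (i); Ch. VIII §6 Thm. 13.
* [BirkenhakeLange2004] C. Birkenhake, H. Lange, *Complex Abelian Varieties* (2004), §11.5 Prop. 11.5.3.
-/

set_option autoImplicit false

noncomputable section

open CategoryTheory AlgebraicGeometry
open Literature.AlgebraicGeometry.Motives Literature.AlgebraicGeometry.Motives.AbelianVariety

universe u

namespace Literature.NumberTheory.Automorphic.Liu2021.AppendixC

/-! ## §0 Dominance of `[N]` transfers between abelian varieties (through `N ≠ 0`) -/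

/-- **If `[N]` is dominant on an abelian variety of positive dimension then `N ≠ 0`**: for `N = 0` the morphism `[0]` is the
constant map to the origin, whose image `{e}` is closed (★ `isClosedImmersion_unitPt`), so it is dense only if `A` is a point.
[cite: MumfordAV1970, §6 Proposition p. 64 (and §4, the origin as a closed point)] -/
theorem natCast_ne_zero_of_isDominant_zsmul {K : Type u} [Field K] (A : AbelianVariety K) (hA : 0 < A.dim) (N : ℕ)
    [hN : IsDominant (Hom.toSchemeHom ((N : ℤ) • 𝟙 A))] : N ≠ 0 := by
  rintro rfl
  have h0 : Hom.toSchemeHom ((((0 : ℕ) : ℤ)) • 𝟙 A) = A.X.hom ≫ unitPt A := by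
    rw [Nat.cast_zero, zero_smul]
    change ((0 : A ⟶ A).hom.hom.hom).left = _
    rw [hom_zero, Grp.Hom.hom_one, Mon.Hom.hom_one, one_left]
  have hdense : DenseRange (Hom.toSchemeHom ((((0 : ℕ) : ℤ)) • 𝟙 A)).base := hN.denseRange
  have hsub : Set.range (Hom.toSchemeHom ((((0 : ℕ) : ℤ)) • 𝟙 A)).base ⊆ Set.range (unitPt A).base := by
    rintro _ ⟨a, rfl⟩
    exact ⟨A.X.hom.base a, by rw [h0]; rfl⟩
  have hclosed : IsClosed (Set.range (unitPt A).base) := (unitPt A).isClosedEmbedding.isClosed_range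
  have huniv : Set.range (unitPt A).base = Set.univ :=
    Set.eq_univ_of_univ_subset ((hdense.closure_eq ▸ closure_minimal hsub hclosed))
  haveI : Subsingleton A.X.left := ⟨fun a b => by
    have ha : a ∈ Set.range (unitPt A).base := huniv ▸ Set.mem_univ a
    have hb : b ∈ Set.range (unitPt A).base := huniv ▸ Set.mem_univ b
    rw [range_unitPt, Set.mem_singleton_iff] at ha hb
    rw [ha, hb]⟩
  have hle := topologicalKrullDim_zero_of_discreteTopology A.X.left
  rw [topologicalKrullDim_left] at hle
  have : A.dim ≤ 0 := by exact_mod_cast hle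
  omega

/-- **Dominance of `[N]` transfers** in characteristic `0`: if `[N]` is dominant on some abelian variety `A` of positive dimension, it is
dominant on every abelian variety `B` over the same field (`N ≠ 0`, and `[N]_B` is an isogeny, ★ `isDominant_toSchemeHom_zsmul_of_ne_zero`).
The `hZ`/`hY` bookkeeping of the level-adjoint calculus. [cite: MumfordAV1970, §6 Proposition p. 64] -/
theorem isDominant_zsmul_of_isDominant_zsmul {K : Type u} [Field K] [CharZero K] (A : AbelianVariety K) (hA : 0 < A.dim)
    (B : AbelianVariety K) (N : ℕ) [IsDominant (Hom.toSchemeHom ((N : ℤ) • 𝟙 A))] :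
    IsDominant (Hom.toSchemeHom ((N : ℤ) • 𝟙 B)) :=
  isDominant_toSchemeHom_zsmul_of_ne_zero B (Nat.cast_ne_zero.2 (natCast_ne_zero_of_isDominant_zsmul A hA N))

/-- Plain letter then weighted letter (bookkeeping; = ★ `AbelianVariety.levelAdjoint_comp_plain_weighted`, restated privately so that this
file does not depend on the edition of ★ `AbelianVarietyLevelAdjointFan` served on the checking node). [folklore] -/
private theorem comp_plain_weighted' {K : Type u} [Field K] {A B C : AbelianVariety K} (ΘA : CartierDivisor A.X.left)
    (ΘB : CartierDivisor B.X.left) (ΘC : CartierDivisor C.X.left) {x₁ : A ⟶ B} {y₁ : B ⟶ A} {x₂ : B ⟶ C} {y₂ : C ⟶ B} {w : ℕ}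
    (h₁ : ∀ (N : ℕ) [IsDominant (Hom.toSchemeHom ((N : ℤ) • 𝟙 A))] [IsDominant (Hom.toSchemeHom ((N : ℤ) • 𝟙 B))]
      (P : A.torsionPoints K N) (Q : B.torsionPoints K N),
      B.weilPairingLevel ΘB ⟨AlgPoints.map x₁.hom.hom.hom P.1, map_mem_torsionPoints x₁ P.2⟩ Q =
        A.weilPairingLevel ΘA P ⟨AlgPoints.map y₁.hom.hom.hom Q.1, map_mem_torsionPoints y₁ Q.2⟩)
    (h₂ : ∀ (N : ℕ) [IsDominant (Hom.toSchemeHom ((N : ℤ) • 𝟙 B))] [IsDominant (Hom.toSchemeHom ((N : ℤ) • 𝟙 C))]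
      (Q : B.torsionPoints K N) (S : C.torsionPoints K N),
      C.weilPairingLevel ΘC ⟨AlgPoints.map ((w : ℤ) • x₂).hom.hom.hom Q.1, map_mem_torsionPoints ((w : ℤ) • x₂) Q.2⟩ S =
        B.weilPairingLevel ΘB Q ⟨AlgPoints.map y₂.hom.hom.hom S.1, map_mem_torsionPoints y₂ S.2⟩)
    (N : ℕ) [IsDominant (Hom.toSchemeHom ((N : ℤ) • 𝟙 A))] [IsDominant (Hom.toSchemeHom ((N : ℤ) • 𝟙 B))]
    [IsDominant (Hom.toSchemeHom ((N : ℤ) • 𝟙 C))] (P : A.torsionPoints K N) (S : C.torsionPoints K N) :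
    C.weilPairingLevel ΘC ⟨AlgPoints.map ((w : ℤ) • (x₁ ≫ x₂)).hom.hom.hom P.1, map_mem_torsionPoints ((w : ℤ) • (x₁ ≫ x₂)) P.2⟩ S =
      A.weilPairingLevel ΘA P ⟨AlgPoints.map (y₂ ≫ y₁).hom.hom.hom S.1, map_mem_torsionPoints (y₂ ≫ y₁) S.2⟩ := by
  have eP : (⟨AlgPoints.map ((w : ℤ) • (x₁ ≫ x₂)).hom.hom.hom P.1, map_mem_torsionPoints ((w : ℤ) • (x₁ ≫ x₂)) P.2⟩ :
        C.torsionPoints K N) =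
      ⟨AlgPoints.map ((w : ℤ) • x₂).hom.hom.hom (AlgPoints.map x₁.hom.hom.hom P.1),
        map_mem_torsionPoints ((w : ℤ) • x₂) (map_mem_torsionPoints x₁ P.2)⟩ :=
    Subtype.ext (show AlgPoints.map ((w : ℤ) • (x₁ ≫ x₂)).hom.hom.hom P.1 = _ by
      rw [← Preadditive.comp_zsmul, map_hom_comp_apply])
  rw [eP, h₂ N ⟨_, map_mem_torsionPoints x₁ P.2⟩ S, h₁ N P ⟨_, map_mem_torsionPoints y₂ S.2⟩, torsionPoints_map_comp]

/-! ## §1 The entry `tt ≫ Nm_{tp}` and its transposed entry -/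

/-- **THE LEVEL ADJOINT OF ONE ENTRY OF A COMPLEX HECKE WORD.**  Data: complex smooth projective geometrically irreducible curves
`X_a, X_c, X_z, X_b` with Jacobians of positive dimension; Galois piece covers `tu : X_c → X_a` (group `H_u ≤ Aut X_c`),
`q : X_z → X_c` (`H_q ≤ Aut X_z`), `u′ : X_z → X_b` (`H_z ≤ Aut X_z`), each a quotient for separated test objects; the DOMINATED piece
`tp : X_c → X_b` with `q ≫ tp = u′`; Riemann theta divisors `W_a, W_c, W_z, W_b` defining the canonical principal polarisations; and
the pinned pull-back `tt` of `tu` (`Nm_{tu} ≫ tt = Σ_{h ∈ H_u} h_*`).  Then there is `tz : J_b → J_z` with `Nm_{u′} ≫ tz = Σ_{h ∈ H_z} h_*`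
(= `u′^*`) such that at every level `N` (dominance of `[N]` on `J_a`, `J_b`):
`ē_N^{W_b}(((#H_q)·(tt ≫ Nm_{tp})) P, Q) = ē_N^{W_a}(P, (tz ≫ Nm_q ≫ Nm_{tu}) Q)` — the entry `tu^* ≫ Nm_{tp}` has the level adjoint
`u′^* ≫ Nm_q ≫ Nm_{tu}` with raw weight `#H_q = deg q` ([MumfordAV1970] §20 (3) for each letter; (F-P2) «`\widehat{f^*} = Nm_f`» for the
three Galois letters; the non-Galois `Nm_{tp}` through its domination `q ≫ tp = u′`, ★ `levelAdjoint_pushforward_of_dominated'`).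
[cite: MumfordAV1970, §20 (p. 186, property (3) of e_n)] [cite: LangeRodriguez2022, §3.2.1 eq. (3.3) (pp. 46–47); §3.5.1 Prop. 3.5.1 (p. 65)]
[cite: Lang1983AbelianVarieties, Ch. VII §2 Thm. 5 (i)] [cite: BirkenhakeLange2004, §11.5 Prop. 11.5.3] -/
theorem Jacobian.exists_entry_levelAdjoint (hFP2 : Jacobian.galoisCover_pullback_isWeilPairingAdjoint_norm)
    {Xa Xc Xz Xb : SchemeOver ℂ} (ha : IsSmoothProjective 1 Xa) (hc : IsSmoothProjective 1 Xc) (hz : IsSmoothProjective 1 Xz)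
    (hb : IsSmoothProjective 1 Xb) (𝒥a : Jacobian Xa) (𝒥c : Jacobian Xc) (𝒥z : Jacobian Xz) (𝒥b : Jacobian Xb)
    (hda : 1 ≤ 𝒥a.J.dim) (hdc : 1 ≤ 𝒥c.J.dim) (hdb : 1 ≤ 𝒥b.J.dim)
    {Hu : Subgroup (Aut Xc)} [Finite Hu] (tu : Xc ⟶ Xa) (hqu : IsSepQuotient (fun h : ↥Hu => (h : Aut Xc)) tu)
    {Hq : Subgroup (Aut Xz)} [Finite Hq] (q : Xz ⟶ Xc) (hqq : IsSepQuotient (fun h : ↥Hq => (h : Aut Xz)) q)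
    {Hz : Subgroup (Aut Xz)} [Finite Hz] (u' : Xz ⟶ Xb) (hqz : IsSepQuotient (fun h : ↥Hz => (h : Aut Xz)) u')
    (tp : Xc ⟶ Xb) (hdom : q ≫ tp = u')
    {Wa : CartierDivisor 𝒥a.J.X.left} {Wc : CartierDivisor 𝒥c.J.X.left} {Wz : CartierDivisor 𝒥z.J.X.left}
    {Wb : CartierDivisor 𝒥b.J.X.left}
    (hWa : 𝒥a.IsRiemannThetaDivisor Wa ∧ 𝒥a.J.IsPrincipalPolarizationDivisor Wa)
    (hWc : 𝒥c.IsRiemannThetaDivisor Wc ∧ 𝒥c.J.IsPrincipalPolarizationDivisor Wc)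
    (hWz : 𝒥z.IsRiemannThetaDivisor Wz ∧ 𝒥z.J.IsPrincipalPolarizationDivisor Wz)
    (hWb : 𝒥b.IsRiemannThetaDivisor Wb ∧ 𝒥b.J.IsPrincipalPolarizationDivisor Wb)
    (tt : 𝒥a.J ⟶ 𝒥c.J)
    (htt : letI := Fintype.ofFinite ↥Hu;
      𝒥c.pushforward 𝒥a tu ≫ tt = ∑ h : ↥Hu, 𝒥c.pushforward 𝒥c (h : Aut Xc).hom) :
    letI := Fintype.ofFinite ↥Hz
    letI := Fintype.ofFinite ↥Hq
    ∃ tz : 𝒥b.J ⟶ 𝒥z.J,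
      𝒥z.pushforward 𝒥b u' ≫ tz = ∑ h : ↥Hz, 𝒥z.pushforward 𝒥z (h : Aut Xz).hom ∧
      ∀ (N : ℕ) [IsDominant (Hom.toSchemeHom ((N : ℤ) • 𝟙 𝒥a.J))] [IsDominant (Hom.toSchemeHom ((N : ℤ) • 𝟙 𝒥b.J))]
        (P : 𝒥a.J.torsionPoints ℂ N) (Q : 𝒥b.J.torsionPoints ℂ N),
        𝒥b.J.weilPairingLevel Wb
            ⟨AlgPoints.map (((Fintype.card ↥Hq : ℕ) : ℤ) • (tt ≫ 𝒥c.pushforward 𝒥b tp)).hom.hom.hom P.1,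
              map_mem_torsionPoints (((Fintype.card ↥Hq : ℕ) : ℤ) • (tt ≫ 𝒥c.pushforward 𝒥b tp)) P.2⟩ Q =
          𝒥a.J.weilPairingLevel Wa P
            ⟨AlgPoints.map (tz ≫ 𝒥z.pushforward 𝒥c q ≫ 𝒥c.pushforward 𝒥a tu).hom.hom.hom Q.1,
              map_mem_torsionPoints (tz ≫ 𝒥z.pushforward 𝒥c q ≫ 𝒥c.pushforward 𝒥a tu) Q.2⟩ := by
  letI := Fintype.ofFinite ↥Hu
  letI := Fintype.ofFinite ↥Hz
  letI := Fintype.ofFinite ↥Hq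
  -- the three Galois packages (pin, degree, adjoint)
  obtain ⟨tq, htq, hdegq, hadjq⟩ := Jacobian.exists_galoisCover_letters hFP2 hz hc 𝒥z 𝒥c hdc Hq.subtype Hq.subtype_injective q
    hqq hWz.1 hWz.2 hWc.1 hWc.2
  obtain ⟨tz, htz, -, hadjz⟩ := Jacobian.exists_galoisCover_letters hFP2 hz hb 𝒥z 𝒥b hdb Hz.subtype Hz.subtype_injective u'
    hqz hWz.1 hWz.2 hWb.1 hWb.2
  have hadju : ∀ (N : ℕ) [IsDominant (Hom.toSchemeHom ((N : ℤ) • 𝟙 𝒥c.J))] [IsDominant (Hom.toSchemeHom ((N : ℤ) • 𝟙 𝒥a.J))]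
      (P : 𝒥a.J.torsionPoints ℂ N) (Q : 𝒥c.J.torsionPoints ℂ N),
      𝒥c.J.weilPairingLevel Wc ⟨AlgPoints.map tt.hom.hom.hom P.1, map_mem_torsionPoints tt P.2⟩ Q =
        𝒥a.J.weilPairingLevel Wa P
          ⟨AlgPoints.map (𝒥c.pushforward 𝒥a tu).hom.hom.hom Q.1, map_mem_torsionPoints (𝒥c.pushforward 𝒥a tu) Q.2⟩ :=
    fun N _ _ P Q => hFP2 Xc Xa hc ha 𝒥c 𝒥a hda (↥Hu) Hu.subtype Hu.subtype_injective tu hqu Wc Wa hWc.1 hWc.2 hWa.1 hWa.2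
      tt htt N P Q
  refine ⟨tz, htz, fun N _ _ P Q => ?_⟩
  -- dominance of `[N]` on the intermediate Jacobians
  haveI : IsDominant (Hom.toSchemeHom ((N : ℤ) • 𝟙 𝒥c.J)) := isDominant_zsmul_of_isDominant_zsmul 𝒥a.J hda 𝒥c.J N
  haveI : IsDominant (Hom.toSchemeHom ((N : ℤ) • 𝟙 𝒥z.J)) := isDominant_zsmul_of_isDominant_zsmul 𝒥a.J hda 𝒥z.J N
  -- the dominated letter `(Nm_{tp}, (1•tz) ≫ Nm_q)` of weight `1 * #H_q` for `(W_c, W_b)`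
  have hnf : 𝒥z.pushforward 𝒥c q ≫ 𝒥c.pushforward 𝒥b tp = 𝒥z.pushforward 𝒥b u' := by
    rw [← Jacobian.pushforward_comp, hdom]
  -- the two Galois letters of `Z = X_z` dressed with the weight `1`
  have hp1 : ∀ (N : ℕ) [IsDominant (Hom.toSchemeHom ((N : ℤ) • 𝟙 𝒥b.J))] [IsDominant (Hom.toSchemeHom ((N : ℤ) • 𝟙 𝒥z.J))]
      (P : 𝒥b.J.torsionPoints ℂ N) (Q : 𝒥z.J.torsionPoints ℂ N),
      𝒥z.J.weilPairingLevel Wz ⟨AlgPoints.map (((1 : ℕ) : ℤ) • tz).hom.hom.hom P.1, map_mem_torsionPoints (((1 : ℕ) : ℤ) • tz) P.2⟩ Q =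
        𝒥b.J.weilPairingLevel Wb P
          ⟨AlgPoints.map (𝒥z.pushforward 𝒥b u').hom.hom.hom Q.1, map_mem_torsionPoints (𝒥z.pushforward 𝒥b u') Q.2⟩ := by
    intro N _ _ P Q
    have e : (⟨AlgPoints.map (((1 : ℕ) : ℤ) • tz).hom.hom.hom P.1, map_mem_torsionPoints (((1 : ℕ) : ℤ) • tz) P.2⟩ :
        𝒥z.J.torsionPoints ℂ N) = ⟨AlgPoints.map tz.hom.hom.hom P.1, map_mem_torsionPoints tz P.2⟩ :=
      Subtype.ext (by rw [Nat.cast_one, one_smul])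
    rw [e]
    exact hadjz N P Q
  have hq1 : ∀ (N : ℕ) [IsDominant (Hom.toSchemeHom ((N : ℤ) • 𝟙 𝒥c.J))] [IsDominant (Hom.toSchemeHom ((N : ℤ) • 𝟙 𝒥z.J))]
      (P : 𝒥c.J.torsionPoints ℂ N) (Q : 𝒥z.J.torsionPoints ℂ N),
      𝒥z.J.weilPairingLevel Wz ⟨AlgPoints.map (((1 : ℕ) : ℤ) • tq).hom.hom.hom P.1, map_mem_torsionPoints (((1 : ℕ) : ℤ) • tq) P.2⟩ Q =
        𝒥c.J.weilPairingLevel Wc P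
          ⟨AlgPoints.map (𝒥z.pushforward 𝒥c q).hom.hom.hom Q.1, map_mem_torsionPoints (𝒥z.pushforward 𝒥c q) Q.2⟩ := by
    intro N _ _ P Q
    have e : (⟨AlgPoints.map (((1 : ℕ) : ℤ) • tq).hom.hom.hom P.1, map_mem_torsionPoints (((1 : ℕ) : ℤ) • tq) P.2⟩ :
        𝒥z.J.torsionPoints ℂ N) = ⟨AlgPoints.map tq.hom.hom.hom P.1, map_mem_torsionPoints tq P.2⟩ :=
      Subtype.ext (by rw [Nat.cast_one, one_smul])
    rw [e]
    exact hadjq N P Q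
  have h₂ := fun (N : ℕ) (_ : IsDominant (Hom.toSchemeHom ((N : ℤ) • 𝟙 𝒥c.J)))
      (_ : IsDominant (Hom.toSchemeHom ((N : ℤ) • 𝟙 𝒥b.J))) (P : 𝒥c.J.torsionPoints ℂ N) (Q : 𝒥b.J.torsionPoints ℂ N) =>
    levelAdjoint_pushforward_of_dominated' Wb Wc Wz hp1 hq1
      hnf hdegq (forall_pow_surjective_of_isDominant 𝒥b.J) (forall_pow_surjective_of_isDominant 𝒥z.J)
      (fun N _ => isDominant_zsmul_of_isDominant_zsmul 𝒥b.J hdb 𝒥z.J N) N P Q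
  -- compose with the plain Galois letter `(tt, Nm_{tu})`
  have key := comp_plain_weighted' Wa Wc Wb (fun N _ _ P Q => hadju N P Q) h₂ N P Q
  -- clean the weights `1 * #H_q` and `(1 : ℤ) • tz`
  have eP : (⟨AlgPoints.map (((1 * Fintype.card ↥Hq : ℕ) : ℤ) • (tt ≫ 𝒥c.pushforward 𝒥b tp)).hom.hom.hom P.1,
        map_mem_torsionPoints (((1 * Fintype.card ↥Hq : ℕ) : ℤ) • (tt ≫ 𝒥c.pushforward 𝒥b tp)) P.2⟩ :
        𝒥b.J.torsionPoints ℂ N) =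
      ⟨AlgPoints.map (((Fintype.card ↥Hq : ℕ) : ℤ) • (tt ≫ 𝒥c.pushforward 𝒥b tp)).hom.hom.hom P.1,
        map_mem_torsionPoints (((Fintype.card ↥Hq : ℕ) : ℤ) • (tt ≫ 𝒥c.pushforward 𝒥b tp)) P.2⟩ :=
    Subtype.ext (by rw [one_mul])
  have eQ : (⟨AlgPoints.map (((((1 : ℕ) : ℤ) • tz) ≫ 𝒥z.pushforward 𝒥c q) ≫ 𝒥c.pushforward 𝒥a tu).hom.hom.hom Q.1,
        map_mem_torsionPoints (((((1 : ℕ) : ℤ) • tz) ≫ 𝒥z.pushforward 𝒥c q) ≫ 𝒥c.pushforward 𝒥a tu) Q.2⟩ :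
        𝒥a.J.torsionPoints ℂ N) =
      ⟨AlgPoints.map (tz ≫ 𝒥z.pushforward 𝒥c q ≫ 𝒥c.pushforward 𝒥a tu).hom.hom.hom Q.1,
        map_mem_torsionPoints (tz ≫ 𝒥z.pushforward 𝒥c q ≫ 𝒥c.pushforward 𝒥a tu) Q.2⟩ :=
    Subtype.ext (by rw [Nat.cast_one, one_smul, Category.assoc])
  rw [eP, eQ] at key
  exact key

/-! ## §2 (ed. 2) The entry with a MULTIPLICITY on the piece trace -/

/-- **Ed. 2: the entry `((m : ℤ) • tt) ≫ Nm_{tp}` — the piece trace carried with its multiplicity.**  In the piecewise trace word the global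
trace of `u : X_N → X_K`, pinned by ALL of `K ∕ N`, restricts on a piece to `m • tt` where `tt` is pinned by the FAITHFUL piece group
`H_u ≤ Aut X_c` and `m = #ker(Stab(c) → Aut X_c) ≥ 1` (A-p07 (g13) `exists_fan_traceWord`); scaling both members of a level adjoint pair by
`m` keeps the weight (★ `levelAdjoint_nsmul`), so from §1: `∃ tz` (pinned pull-back of `u′`) with
`ē_N^{W_b}(((#H_q)·(((m:ℤ)•tt) ≫ Nm_{tp})) P, Q) = ē_N^{W_a}(P, ((m:ℤ) • (tz ≫ Nm_q ≫ Nm_{tu})) Q)` — same raw weight `#H_q`.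
[cite: MumfordAV1970, §20 (p. 186, property (3) of e_n)] [cite: LangeRodriguez2022, §3.2.1 eq. (3.3) (pp. 46–47); §3.5.1 Prop. 3.5.1 (p. 65)]
[cite: Lang1983AbelianVarieties, Ch. VII §2 Thm. 5 (i)] -/
theorem Jacobian.exists_entry_levelAdjoint_smul (hFP2 : Jacobian.galoisCover_pullback_isWeilPairingAdjoint_norm)
    {Xa Xc Xz Xb : SchemeOver ℂ} (ha : IsSmoothProjective 1 Xa) (hc : IsSmoothProjective 1 Xc) (hz : IsSmoothProjective 1 Xz)
    (hb : IsSmoothProjective 1 Xb) (𝒥a : Jacobian Xa) (𝒥c : Jacobian Xc) (𝒥z : Jacobian Xz) (𝒥b : Jacobian Xb)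
    (hda : 1 ≤ 𝒥a.J.dim) (hdc : 1 ≤ 𝒥c.J.dim) (hdb : 1 ≤ 𝒥b.J.dim)
    {Hu : Subgroup (Aut Xc)} [Finite Hu] (tu : Xc ⟶ Xa) (hqu : IsSepQuotient (fun h : ↥Hu => (h : Aut Xc)) tu)
    {Hq : Subgroup (Aut Xz)} [Finite Hq] (q : Xz ⟶ Xc) (hqq : IsSepQuotient (fun h : ↥Hq => (h : Aut Xz)) q)
    {Hz : Subgroup (Aut Xz)} [Finite Hz] (u' : Xz ⟶ Xb) (hqz : IsSepQuotient (fun h : ↥Hz => (h : Aut Xz)) u')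
    (tp : Xc ⟶ Xb) (hdom : q ≫ tp = u')
    {Wa : CartierDivisor 𝒥a.J.X.left} {Wc : CartierDivisor 𝒥c.J.X.left} {Wz : CartierDivisor 𝒥z.J.X.left}
    {Wb : CartierDivisor 𝒥b.J.X.left}
    (hWa : 𝒥a.IsRiemannThetaDivisor Wa ∧ 𝒥a.J.IsPrincipalPolarizationDivisor Wa)
    (hWc : 𝒥c.IsRiemannThetaDivisor Wc ∧ 𝒥c.J.IsPrincipalPolarizationDivisor Wc)
    (hWz : 𝒥z.IsRiemannThetaDivisor Wz ∧ 𝒥z.J.IsPrincipalPolarizationDivisor Wz)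
    (hWb : 𝒥b.IsRiemannThetaDivisor Wb ∧ 𝒥b.J.IsPrincipalPolarizationDivisor Wb)
    (tt : 𝒥a.J ⟶ 𝒥c.J)
    (htt : letI := Fintype.ofFinite ↥Hu;
      𝒥c.pushforward 𝒥a tu ≫ tt = ∑ h : ↥Hu, 𝒥c.pushforward 𝒥c (h : Aut Xc).hom) (m : ℕ) :
    letI := Fintype.ofFinite ↥Hz
    letI := Fintype.ofFinite ↥Hq
    ∃ tz : 𝒥b.J ⟶ 𝒥z.J,
      𝒥z.pushforward 𝒥b u' ≫ tz = ∑ h : ↥Hz, 𝒥z.pushforward 𝒥z (h : Aut Xz).hom ∧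
      ∀ (N : ℕ) [IsDominant (Hom.toSchemeHom ((N : ℤ) • 𝟙 𝒥a.J))] [IsDominant (Hom.toSchemeHom ((N : ℤ) • 𝟙 𝒥b.J))]
        (P : 𝒥a.J.torsionPoints ℂ N) (Q : 𝒥b.J.torsionPoints ℂ N),
        𝒥b.J.weilPairingLevel Wb
            ⟨AlgPoints.map (((Fintype.card ↥Hq : ℕ) : ℤ) • (((m : ℤ) • tt) ≫ 𝒥c.pushforward 𝒥b tp)).hom.hom.hom P.1,
              map_mem_torsionPoints (((Fintype.card ↥Hq : ℕ) : ℤ) • (((m : ℤ) • tt) ≫ 𝒥c.pushforward 𝒥b tp)) P.2⟩ Q =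
          𝒥a.J.weilPairingLevel Wa P
            ⟨AlgPoints.map ((m : ℤ) • (tz ≫ 𝒥z.pushforward 𝒥c q ≫ 𝒥c.pushforward 𝒥a tu)).hom.hom.hom Q.1,
              map_mem_torsionPoints ((m : ℤ) • (tz ≫ 𝒥z.pushforward 𝒥c q ≫ 𝒥c.pushforward 𝒥a tu)) Q.2⟩ := by
  letI := Fintype.ofFinite ↥Hz
  letI := Fintype.ofFinite ↥Hq
  obtain ⟨tz, htz, hadj⟩ := Jacobian.exists_entry_levelAdjoint hFP2 ha hc hz hb 𝒥a 𝒥c 𝒥z 𝒥b hda hdc hdb tu hqu q hqq u' hqz tp hdom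
    hWa hWc hWz hWb tt htt
  refine ⟨tz, htz, fun N _ _ P Q => ?_⟩
  have key := levelAdjoint_nsmul Wa Wb hadj m N P Q
  have eP : (⟨AlgPoints.map (((Fintype.card ↥Hq : ℕ) : ℤ) • (((m : ℤ) • tt) ≫ 𝒥c.pushforward 𝒥b tp)).hom.hom.hom P.1,
        map_mem_torsionPoints (((Fintype.card ↥Hq : ℕ) : ℤ) • (((m : ℤ) • tt) ≫ 𝒥c.pushforward 𝒥b tp)) P.2⟩ :
        𝒥b.J.torsionPoints ℂ N) =
      ⟨AlgPoints.map (((Fintype.card ↥Hq : ℕ) : ℤ) • ((m : ℤ) • (tt ≫ 𝒥c.pushforward 𝒥b tp))).hom.hom.hom P.1,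
        map_mem_torsionPoints (((Fintype.card ↥Hq : ℕ) : ℤ) • ((m : ℤ) • (tt ≫ 𝒥c.pushforward 𝒥b tp))) P.2⟩ :=
    Subtype.ext (by rw [Preadditive.zsmul_comp])
  rw [eP]
  exact key

end Literature.NumberTheory.Automorphic.Liu2021.AppendixC

end
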